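import Mathlib
import Summits.NavierStokesRegularity.NavierStokesRegularity.Theses.WakeRatchet
import HarnessLib

/-!
# `WakeRatchet.Assembly` — the route's assembly (item stmt-NavierStokesRegularity-21811; pure logic)

**Statement.** `TailRatchet → TailEnvelopeFinite → RatchetStarvation → EternalRigidityViscBddOne →
TaoLadderRungTwoBreak.Target`.

PROOF. The route file `Theses/WakeRatchet.lean` carries the planner-authored, kernel-checked
deciding theorem `Theses.WakeRatchet.closes`, whose hypotheses are exactly the route's two cruxes
and two supports and whose conclusion is the rung leaf `TaoLadderRungTwoBreak.Target` (TL-M2Break,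
D-0061); the assembly item is that implication written as ONE proposition, so it is closed by
applying `closes` to the hypotheses.

HONEST FRAMING: glue between the route's own statements about bounded eternal solutions of a MODEL
lattice (Tao 2016 §4); nothing here is a statement about the Navier–Stokes equations, and the rung
leaf is not the summit Statement.
-/

noncomputable section

set_option linter.dupNamespace false

namespace Summit.NavierStokesRegularity.NavierStokesRegularity.Theorems

open Summit.NavierStokesRegularity.NavierStokesRegularity.Theses.WakeRatchet in
/-- **Item stmt-NavierStokesRegularity-21811** (`WakeRatchet.Assembly`): the route's two cruxes and
two supports imply its rung leaf `TaoLadderRungTwoBreak.Target`, by the route file's deciding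
theorem `closes`. [this file] -/
theorem wakeRatchet_assembly_proof :
    Summit.NavierStokesRegularity.NavierStokesRegularity.Theses.WakeRatchet.Assembly := by
  unfold Summit.NavierStokesRegularity.NavierStokesRegularity.Theses.WakeRatchet.Assembly
  -- (buildfix 2026-08-28) the route's `closes` was re-keyed (04:20Z) to `TailRateRatchet` (contraction
  -- `(1+ε₀)^(-a)`); this CLOSED assembly keeps its accepted statement over `TailRatchet` (a FIXED contraction
  -- `1 - w`), so the pre-edit chain is inlined: shrink the scale window to `ε₀ ≤ min εs (w/2)` so that
  -- `(1+ε₀)(1-w) < 1`, then starvation (h₃) fed by the finite envelope (h₂) and the ratchet (h₁), and the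
  -- eternal-rigidity door (h₄), exactly as the route file's deciding theorem.
  intro h₁ h₂ h₃ h₄ R hR
  refine Literature.Analysis.FluidPDE.TaoCascade.noRobustBlowupBelow_of_eternalViscBdd ?_ (h₄ R hR)
  obtain ⟨w, hw, εs, hεs, H⟩ := h₁ R hR
  refine ⟨min εs (w / 2), lt_min hεs (by linarith), ?_⟩
  intro ε₀ hε₀ hle α hα νh W hW hU
  have hle₁ : ε₀ ≤ εs := le_trans hle (min_le_left _ _)
  have hle₂ : ε₀ ≤ w / 2 := le_trans hle (min_le_right _ _)
  have hprod : (1 + ε₀) * (1 - w) < 1 := by nlinarith [mul_pos hε₀ hw, hle₂]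
  refine h₃ ε₀ w νh α W hε₀ hw hprod hW hU (h₂ ε₀ νh α W hε₀ hα.2.1 hW hU) ?_
  intro n M hM σ
  exact H ε₀ hε₀ hle₁ α hα νh W hW hU n M hM σ

end Summit.NavierStokesRegularity.NavierStokesRegularity.Theorems

end
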